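import Summits.MatrixMultiplication.OmegaCensus.STPPVosperSlackOneLawMult

/-!
# ω-census (abelian STPP census): a fourth SLACK-1 kill at `ℤ₆₁` modulo Hamidoune–Rødseth, by the enlarged table target (kernel)

HONEST FRAMING (pub-omega census; verbatim): lottery ticket; floor = certified bounds/negative ranges.
Census STRUCTURE (seat pub-omega-stpp-1 gen 30, 2026-08-28), family (b2).  Application of `no_isSTPP_of_slack_one_tables_prime_mult`
(`STPPVosperSlackOneLawMult.lean`); CONDITIONAL on `HamidouneRodsethInverseTheorem` (stated as printed in `STPPVosperSlackOneSteps.lean`, NOT proved in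
the tree) — the leaf becomes "kernel-dead MODULO a published inverse theorem", not kernel-dead.  Nothing here is progress on `ω`.

The pattern `{(1,1,2),(2,3,3),(3,3,2),(3,4,2)}` is a minimal beating pattern of `ℤ₆₁` (`Σ aᵢbᵢcᵢ = 62`) alive under the python filters N7–N20, out of
reach of the N18-tight laws, ENGINE-dead through the pair cores of record, and NOT killed by the plain slack-1 law: in the reading `(a,b,c)` at the block
`(3,4,2)` (`(z, b, vol, a, L) = (14, 4, 24, 3, 17)`, `(n, m) = (43, 19)`) its case-α and case-β tables leave the steps `j = ±2⁻¹ = 30, 31 (mod 61)`, i.e.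
`e′ = ±2d` — which the enlarged target excludes because `Aᵢ` (an almost-progression of step `d` with `a = 3` terms) contains a pair at distance `2d`.
Target `J = {0, 1, 60, 2, 59, 3, 58, 31, 30}` = `{0, ±1, ±2, ±3, ±2⁻¹}`.  Independent python reading of the three tables: HOME
`pub-omega-stpp-1-g30/code/lean_tables.py` with this `J` (all `True`); the survivor analysis: `code/slack1_scan3.py`.

References: Y. O. Hamidoune, Ø. J. Rødseth, Acta Arith. 92 (2000) 251–262; A. G. Vosper, J. London Math. Soc. 31 (1956); M. B. Nathanson, GTM 165,
Thm 2.7; H. Cohn, R. Kleinberg, B. Szegedy, C. Umans, FOCS 2005 (arXiv:math/0511460), Def. 5.1.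
-/

open Finset
open scoped Pointwise

namespace Summit.MatrixMultiplication.OmegaCensus.CubeNB

open Literature.Computability.AlgebraicComplexity
open Literature.Combinatorics.Additive
open Summit.MatrixMultiplication.OmegaCensus.STPPKneser

/-! ## The target and the three tables -/

section Tables

/-- The enlarged target at `61` for `(a, b) = (3, 4)`: every element is `0`, `±k` with `k < 4`, or `±k⁻¹` with `k < 3`. [folklore] -/
theorem target_61_a3_b4 : ∀ jv ∈ ({0, 1, 60, 2, 59, 3, 58, 31, 30} : Finset ℕ),
    jv = 0 ∨ (∃ k ∈ range 4, 1 ≤ k ∧ (jv = k ∨ jv + k = 61)) ∨ (∃ k ∈ range 3, 1 ≤ k ∧ (jv * k % 61 = 1 ∨ jv * k % 61 = 61 - 1)) := by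
  decide

/-- Tight-type table `(n, m, r) = (43, 19, 4)` at `61` with the enlarged target. [folklore] -/
theorem table_43_19_4_mult : ∀ j < 61, ∀ t < 61, (∀ i < 19, (t + j * i) % 61 < 43) →
    (∀ k < 19, 4 ∣ (t + j * k) % 61 - #((range 19).filter fun i => (t + j * i) % 61 < (t + j * k) % 61)) →
    j ∈ ({0, 1, 60, 2, 59, 3, 58, 31, 30} : Finset ℕ) := by
  decide +kernel

/-- Case-α table `(44, 21, 4)` at `61` with the enlarged target. [folklore] -/
theorem tableAlpha_61_44_21_4_mult : tableAlpha 61 44 21 4 {0, 1, 60, 2, 59, 3, 58, 31, 30} = true := by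
  decide +kernel

/-- Case-β table `(44, 19, 4)` at `61` with the enlarged target. [folklore] -/
theorem tableBeta_61_44_19_4_mult : tableBeta 61 44 19 4 {0, 1, 60, 2, 59, 3, 58, 31, 30} = true := by
  decide +kernel

end Tables

/-! ## The kill -/

section Kills

/-- **`{(1,1,2),(2,3,3),(3,3,2),(3,4,2)}` has no STPP family in `ℤ₆₁`, PROVIDED the Hamidoune–Rødseth inverse theorem** (enlarged-target slack-1 law,
reading `(a,b,c)`, block `(3,4,2)`: `(z, b, vol, a, L) = (14, 4, 24, 3, 17)`, tables `(43,19,4)`, α `(44,21,4)`, β `(44,19,4)`, target `{0, ±1, ±2, ±3, ±2⁻¹}`).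
[cite: CohnKleinbergSzegedyUmans2005, Def. 5.1] [cite: HamidouneRodseth2000, main theorem (§1, p. 252)] [cite: Nathanson1996, Thm 2.7] -/
theorem no_isSTPP_zmod61_112_233_332_342_of_hamidouneRodseth (hHR : HamidouneRodsethInverseTheorem)
    (A B C : Fin 4 → Finset (ZMod 61)) (hS : IsSTPP A B C)
    (hA : ∀ i, #(A i) = ![1, 2, 3, 3] i) (hB : ∀ i, #(B i) = ![1, 3, 3, 4] i) (hC : ∀ i, #(C i) = ![2, 3, 2, 2] i) :
    False := by
  haveI : Fact (Nat.Prime 61) := ⟨prime_61⟩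
  have hAne : ∀ i, (A i).Nonempty := fun i => card_pos.1 (by rw [hA]; fin_cases i <;> simp)
  have hBne : ∀ i, (B i).Nonempty := fun i => card_pos.1 (by rw [hB]; fin_cases i <;> simp)
  have hCne : ∀ i, (C i).Nonempty := fun i => card_pos.1 (by rw [hC]; fin_cases i <;> simp)
  have e3 : (univ : Finset (Fin 4)).erase 3 = {0, 1, 2} := by decide
  have hz : ∑ k ∈ (univ : Finset (Fin 4)).erase 3, #(A k) * #(C k) = 14 := by
    rw [e3]; simp [Finset.sum_insert, hA, hC]
  have hL : ∑ k ∈ (univ : Finset (Fin 4)).erase 3, #(B k) * #(C k) = 17 := by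
    rw [e3]; simp [Finset.sum_insert, hB, hC]
  have ha : #(A 3) = 3 := by rw [hA]; simp
  have hb : #(B 3) = 4 := by rw [hB]; simp
  have hvol : #(A 3) * #(B 3) * #(C 3) = 24 := by rw [hA, hB, hC]; simp
  exact no_isSTPP_of_slack_one_tables_prime_mult hHR A B C hS hAne hBne hCne 3 ⟨0, by decide⟩ ha hb hvol hz hL (by norm_num) (by norm_num)
    (by norm_num) (by norm_num) (by norm_num) (m := 19) (n := 43) rfl rfl target_61_a3_b4 table_43_19_4_mult tableAlpha_61_44_21_4_mult
    tableBeta_61_44_19_4_mult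

end Kills

end Summit.MatrixMultiplication.OmegaCensus.CubeNB
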